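import Summits.Schanuel.Schanuel.Theorems.ZilberEacGraphExpAlgebraicRamified
import HarnessLib

/-!
# Arbitrary base branches, III: the ALGEBRAIC CORE with an analytic, algebraic second coordinate —
# a relation for `exp(α(z) - Π(R z))`, `C R^k = z - L - τ`, makes `L` algebraic

HONEST FRAMING.  Cell `pub-schanuel` (Zilber's Exponential-Algebraic Closedness, case ladder;
host summit Schanuel), seat 2, gen 28.  File LXI (`isAlgebraic_log_of_graphExp_relation_ramified`)
is the algebraic heart of the transcendence method over a polynomial graph `x₁ = p(x₀)`: with the
chart `C·R^k = z - L - τ` of a ramified cycle (`L = log(ρ/θ)`, `L' = g` algebraic over `ℂ[zGerm]`,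
`g(z₀) ≠ 1`), a relation `H(z, exp(p(z) - Π(R z))) = 0` with `deg Π ≥ k + 1` forces the germ of `L`
to be algebraic over `ℂ[zGerm]`.  The polynomial `p` enters that proof only through "`p'` is
algebraic over `ℂ[zGerm]`".  Over an ARBITRARY algebraic base curve the second additive coordinate
along a branch is an analytic function `α(z)` of `z = x₀` whose derivative `β = α'` is algebraic over
`ℂ[zGerm]` (for `α` is a branch of the algebraic curve).  This file proves the core in that form:
**`isAlgebraic_log_of_branchExp_relation_ramified`** — `L' = g` algebraic with `g(z₀) ≠ 1`,
`α' = β` algebraic, `C·R^k = z - L - τ` (`k ≥ 1`), `deg Π ≥ k + 1`, `H ≠ 0` with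
`H(z, exp(α z - Π(R z))) = 0` near `z₀` ⟹ the germ of `L` is algebraic over `ℂ[zGerm]`.  (Proof of
file LXI word for word: the minimal relation differentiated gives `E + q'·D = 0`,
`q' = β - Π'(R)R'`, `D ≠ 0`; with `C k R^{k-1} R' = 1 - g` this is `a·Π'(R) = b·R^{k-1}`, `a ≠ 0`,
`a, b` algebraic, so `R` — a root of `a Π'(X) - b X^{k-1}`, nonzero as `deg Π' ≥ k` — is algebraic
over `ℂ[zGerm, a, b]`, hence over `ℂ[zGerm]`, and `L = z - τ - C R^k` too.)  Also
**`isAlgebraic_deriv_of_algebraic_branch`**: the derivative of a zero-free analytic branch of an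
irreducible curve of positive degree is algebraic over `ℂ[zGerm]` (file LXI's logarithmic derivative
times the branch).  [folklore differential algebra] (new in this form); nothing here is specific to
Schanuel's conjecture (neither used nor implied); Mantova–Masser's question (PLMS 2024 §1 p. 5) and
EC(3,2) stay OPEN.
-/

noncomputable section

open Filter Topology Polynomial

set_option linter.dupNamespace false

namespace Summit.Schanuel.Schanuel.Theorems

/-! ## Part A. The derivative of an algebraic branch is algebraic -/

/-- **The derivative of a zero-free analytic branch of an irreducible curve is algebraic over
`ℂ[zGerm]`.**  `α` analytic with `α(z₀) ≠ 0`, `α' = β` near `z₀`, `A(z, α z) = 0` near `z₀` for an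
irreducible `A ∈ ℂ[s][t]` of positive `t`-degree ⟹ the germ of `β` is algebraic (`β = α·(α'/α)`,
both factors algebraic by file LXI). [folklore] -/
theorem isAlgebraic_deriv_of_algebraic_branch {z₀ : ℂ} {α β : ℂ → ℂ} (hαan : AnalyticAt ℂ α z₀)
    (hβan : AnalyticAt ℂ β z₀) (hα : ∀ᶠ z in 𝓝 z₀, HasDerivAt α (β z) z)
    {A : ℂ[X][X]} (hAirr : Irreducible A) (hA1 : A.natDegree ≠ 0) (hα0 : α z₀ ≠ 0)
    (hA : ∀ᶠ z in 𝓝 z₀, (A.map (Polynomial.evalRingHom z)).eval (α z) = 0) :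
    IsAlgebraic (Algebra.adjoin ℂ ({zGerm z₀} : Set (AGerm z₀))) (AGerm.mk z₀ hβan) := by
  -- `g = β/α` is analytic at `z₀` and `α' = α g`
  have hgan : AnalyticAt ℂ (fun z => β z / α z) z₀ := hβan.div hαan hα0
  have hαne : ∀ᶠ z in 𝓝 z₀, α z ≠ 0 := hαan.continuousAt.eventually_ne hα0
  have hαg : ∀ᶠ z in 𝓝 z₀, HasDerivAt α (α z * (β z / α z)) z := by
    filter_upwards [hα, hαne] with z hz hz0
    refine hz.congr_deriv ?_
    rw [mul_div_cancel₀ _ hz0]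
  have hgalg := isAlgebraic_logDeriv_of_irreducible hαan hgan hαg hAirr hA1 hα0 hA
  have hαalg : IsAlgebraic (Algebra.adjoin ℂ ({zGerm z₀} : Set (AGerm z₀))) (AGerm.mk z₀ hαan) :=
    isAlgebraic_of_germEval₂_eq_zero _ hAirr.ne_zero ((germEval₂_mk_eq_zero_iff hαan A).2 hA)
  have e : AGerm.mk z₀ hβan = AGerm.mk z₀ hαan * AGerm.mk z₀ hgan := by
    rw [← AGerm.mk_mul, AGerm.mk_eq_mk_iff]
    filter_upwards [hαne] with z hz0
    simp only [Pi.mul_apply]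
    rw [mul_div_cancel₀ _ hz0]
  rw [e]
  exact hαalg.mul hgalg

/-! ## Part B. A relation for `exp(α(z) - Π(R z))`, `C R^k = z - L - τ`, makes `L` algebraic -/

/-- **The algebraic conclusion along a ramified cycle over an arbitrary base branch.**  See the
module docstring. [folklore differential algebra] (new in this form) -/
theorem isAlgebraic_log_of_branchExp_relation_ramified {z₀ : ℂ} {L g R α β : ℂ → ℂ}
    (hLan : AnalyticAt ℂ L z₀) (hgan : AnalyticAt ℂ g z₀) (hL : ∀ᶠ z in 𝓝 z₀, HasDerivAt L (g z) z)
    (hgalg : IsAlgebraic (Algebra.adjoin ℂ ({zGerm z₀} : Set (AGerm z₀))) (AGerm.mk z₀ hgan))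
    (hg1 : g z₀ ≠ 1)
    (hαan : AnalyticAt ℂ α z₀) (hβan : AnalyticAt ℂ β z₀) (hαβ : ∀ᶠ z in 𝓝 z₀, HasDerivAt α (β z) z)
    (hβalg : IsAlgebraic (Algebra.adjoin ℂ ({zGerm z₀} : Set (AGerm z₀))) (AGerm.mk z₀ hβan))
    (hRan : AnalyticAt ℂ R z₀) {C τ : ℂ} {k : ℕ} (hk : 1 ≤ k)
    (hR : ∀ᶠ z in 𝓝 z₀, C * R z ^ k = z - L z - τ)
    (Pt : ℂ[X]) (hPt : k + 1 ≤ Pt.natDegree) {H : ℂ[X][X]} (hH0 : H ≠ 0)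
    (hH : ∀ᶠ z in 𝓝 z₀, (H.map (Polynomial.evalRingHom z)).eval
      (Complex.exp (α z - Pt.eval (R z))) = 0) :
    IsAlgebraic (Algebra.adjoin ℂ ({zGerm z₀} : Set (AGerm z₀))) (AGerm.mk z₀ hLan) := by
  classical
  -- the functions and their germs
  set R' : ℂ → ℂ := deriv R with hR'
  have hR'an : AnalyticAt ℂ R' z₀ := hRan.deriv
  have hRd : ∀ᶠ z in 𝓝 z₀, HasDerivAt R (R' z) z := by
    filter_upwards [hRan.eventually_analyticAt] with z hz using hz.differentiableAt.hasDerivAt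
  have hPtan : AnalyticAt ℂ (fun z => Pt.eval (R z)) z₀ := analyticAt_polynomial_eval_comp hRan Pt
  have hPt'an : AnalyticAt ℂ (fun z => (derivative Pt).eval (R z)) z₀ :=
    analyticAt_polynomial_eval_comp hRan (derivative Pt)
  set q : ℂ → ℂ := fun z => α z - Pt.eval (R z) with hq
  have hqan : AnalyticAt ℂ q z₀ := hαan.sub hPtan
  set w : ℂ → ℂ := fun z => Complex.exp (q z) with hw
  have hwan : AnalyticAt ℂ w z₀ := hqan.cexp
  set q' : ℂ → ℂ := fun z => β z - (derivative Pt).eval (R z) * R' z with hq'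
  have hq'an : AnalyticAt ℂ q' z₀ := hβan.sub (hPt'an.mul hR'an)
  set wO := AGerm.mk z₀ hwan with hwO
  set LO := AGerm.mk z₀ hLan with hLO
  set gO := AGerm.mk z₀ hgan with hgO
  set RO := AGerm.mk z₀ hRan with hRO
  set R'O := AGerm.mk z₀ hR'an with hR'O
  set βO := AGerm.mk z₀ hβan with hβO
  have hwO0 : wO ≠ 0 := AGerm.mk_ne_zero_of_forall_ne_zero hwan fun z => Complex.exp_ne_zero _
  -- the differentiated chart identity `C k R^{k-1} R' = 1 - g`
  have hRR : ∀ᶠ z in 𝓝 z₀, (fun y => C * R y ^ k) =ᶠ[𝓝 z] (fun y => y - L y - τ) :=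
    eventually_eventually_nhds.2 hR
  have hkey : ∀ᶠ z in 𝓝 z₀, C * ((k : ℂ) * R z ^ (k - 1) * R' z) = 1 - g z := by
    filter_upwards [hRd, hL, hRR] with z hRz hLz hRRz
    have h1 : HasDerivAt (fun y => C * R y ^ k) (C * ((k : ℂ) * R z ^ (k - 1) * R' z)) z :=
      (hRz.fun_pow k).const_mul C
    have h2 : HasDerivAt (fun y => y - L y - τ) (1 - g z) z :=
      ((hasDerivAt_id z).sub hLz).sub_const τ
    exact (h1.congr_of_eventuallyEq hRRz.symm).unique h2
  have hkeyO : (algebraMap ℂ (AGerm z₀) (C * k)) * RO ^ (k - 1) * R'O = 1 - gO := by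
    have h1an : AnalyticAt ℂ (fun z => C * ((k : ℂ) * R z ^ (k - 1) * R' z)) z₀ :=
      analyticAt_const.mul ((analyticAt_const.mul (hRan.pow _)).mul hR'an)
    have h2an : AnalyticAt ℂ (fun z => 1 - g z) z₀ := analyticAt_const.sub hgan
    have h := (AGerm.mk_eq_mk_iff h1an h2an).2 hkey
    have e1 : AGerm.mk z₀ h1an = (algebraMap ℂ (AGerm z₀) (C * k)) * RO ^ (k - 1) * R'O := by
      rw [← AGerm.mk_const, hRO, hR'O, ← AGerm.mk_pow, ← AGerm.mk_mul, ← AGerm.mk_mul]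
      exact AGerm.mk_congr _ _ fun z => by simp only [Pi.mul_apply, Pi.pow_apply]; ring
    have e2 : AGerm.mk z₀ h2an = 1 - gO := by
      rw [hgO, ← AGerm.mk_one, ← AGerm.mk_sub]
    rw [← e1, ← e2, h]
  -- a relation of minimal degree
  have hHO : germEval₂ z₀ wO H = 0 := (germEval₂_mk_eq_zero_iff hwan H).2 hH
  clear hH
  obtain ⟨H, hH0, hHO, hmin⟩ := exists_minDegree_of_exists (germEval₂ z₀ wO) ⟨H, hH0, hHO⟩
  set M := H.natDegree with hM
  -- the differentiated function identity
  have hF : (fun z => (H.map (Polynomial.evalRingHom z)).eval (w z)) =ᶠ[𝓝 z₀] 0 :=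
    (germEval₂_mk_eq_zero_iff hwan H).1 hHO
  have hFF : ∀ᶠ z in 𝓝 z₀, (fun y => (H.map (Polynomial.evalRingHom y)).eval (w y)) =ᶠ[𝓝 z] 0 :=
    eventually_eventually_nhds.2 hF
  have hE : ∀ᶠ z in 𝓝 z₀, ((coeffDeriv H).map (Polynomial.evalRingHom z)).eval (w z) +
      q' z * ((weightDeg H).map (Polynomial.evalRingHom z)).eval (w z) = 0 := by
    filter_upwards [hRd, hFF, hαβ] with z hRz hFz hαz
    -- `q` and `w` are differentiable at `z` with `w' = w q'`
    have hqd : HasDerivAt q (q' z) z := by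
      have h2 : HasDerivAt (fun y => Pt.eval (R y)) ((derivative Pt).eval (R z) * R' z) z :=
        HasDerivAt.comp z (h₂ := fun y => Pt.eval y) (Polynomial.hasDerivAt Pt (R z)) hRz
      exact hαz.sub h2
    have hwd : HasDerivAt w (w z * q' z) z := hqd.cexp
    -- derivative of `F`
    have e : (fun y => (H.map (Polynomial.evalRingHom y)).eval (w y)) =
        fun y => ∑ j ∈ Finset.range (M + 1), (H.coeff j).eval y * w y ^ j :=
      funext fun y => evalPP_eq_sum H y (w y) (Nat.lt_succ_self _)
    have hderF : HasDerivAt (fun y => (H.map (Polynomial.evalRingHom y)).eval (w y))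
        (∑ j ∈ Finset.range (M + 1), ((derivative (H.coeff j)).eval z * w z ^ j +
          (H.coeff j).eval z * ((j : ℂ) * w z ^ (j - 1) * (w z * q' z)))) z := by
      rw [e]
      exact HasDerivAt.fun_sum fun j _ => (Polynomial.hasDerivAt (H.coeff j) z).fun_mul (hwd.fun_pow j)
    have hzero := hderF.unique ((hasDerivAt_const z (0 : ℂ)).congr_of_eventuallyEq hFz)
    rw [eval_coeffDeriv, eval_weightDeg, Finset.mul_sum, ← Finset.sum_add_distrib, ← hzero]
    refine Finset.sum_congr rfl fun j _ => ?_
    rcases Nat.eq_zero_or_pos j with hj | hj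
    · subst hj; simp
    · obtain ⟨k, rfl⟩ : ∃ k, j = k + 1 := ⟨j - 1, (Nat.sub_add_cancel hj).symm⟩
      simp only [Nat.add_sub_cancel, pow_succ]
      ring
  -- the identity in the germ domain
  have hq'O : AGerm.mk z₀ hq'an = βO - Polynomial.aeval RO (derivative Pt) * R'O := by
    rw [hβO, hRO, aeval_mk hRan (derivative Pt) hPt'an, hR'O, ← AGerm.mk_mul, ← AGerm.mk_sub]
  set D : AGerm z₀ := germEval₂ z₀ wO (weightDeg H) with hD
  set E : AGerm z₀ := germEval₂ z₀ wO (coeffDeriv H) with hEdef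
  have hEO : E + AGerm.mk z₀ hq'an * D = 0 := by
    have hEan : AnalyticAt ℂ (fun z => ((coeffDeriv H).map (Polynomial.evalRingHom z)).eval (w z) +
        q' z * ((weightDeg H).map (Polynomial.evalRingHom z)).eval (w z)) z₀ :=
      (analyticAt_evalPP hwan _).add (hq'an.mul (analyticAt_evalPP hwan _))
    have h := (AGerm.mk_eq_zero_iff hEan).2 hE
    rw [hD, hEdef, germEval₂_mk, germEval₂_mk]
    exact h
  rw [hq'O] at hEO
  -- `D ≠ 0`, `1 - g ≠ 0`
  have hD0 : D ≠ 0 := germEval₂_weightDeg_ne_zero hwO0 hH0 hHO hmin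
  have h1g : (1 : AGerm z₀) - gO ≠ 0 := by
    have h1gan : AnalyticAt ℂ (fun z => 1 - g z) z₀ := analyticAt_const.sub hgan
    have : (1 : AGerm z₀) - gO = AGerm.mk z₀ h1gan := rfl
    rw [this]
    exact AGerm.mk_ne_zero_of_apply_ne_zero h1gan (sub_ne_zero.2 (Ne.symm hg1))
  -- `a · Π'(R) = b · R^{k-1}` with `a = (1 - g) D`, `b = C k (β D + E)`
  set a : AGerm z₀ := (1 - gO) * D with ha
  set ν : AGerm z₀ := βO * D + E with hν
  set b : AGerm z₀ := algebraMap ℂ (AGerm z₀) (C * k) * ν with hb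
  have ha0 : a ≠ 0 := mul_ne_zero h1g hD0
  have hab : a * Polynomial.aeval RO (derivative Pt) = b * RO ^ (k - 1) := by
    have h1 : Polynomial.aeval RO (derivative Pt) * R'O * D = ν := by
      rw [hν]; linear_combination -hEO
    rw [ha, hb, ← hkeyO]
    linear_combination (algebraMap ℂ (AGerm z₀) (C * k)) * RO ^ (k - 1) * h1
  -- algebraicity over `ℂ[zGerm]`
  set Bz := Algebra.adjoin ℂ ({zGerm z₀} : Set (AGerm z₀)) with hBz
  have hwalg : IsAlgebraic Bz wO := isAlgebraic_of_germEval₂_eq_zero wO hH0 hHO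
  have hzalg : IsAlgebraic Bz (zGerm z₀) := isAlgebraic_aeval_zGerm z₀ Polynomial.X |> fun h => by
    rwa [Polynomial.aeval_X] at h
  have hDalg : IsAlgebraic Bz D := isAlgebraic_germEval₂ hwalg _
  have haalg : IsAlgebraic Bz a := (isAlgebraic_one.sub hgalg).mul hDalg
  have hνalg : IsAlgebraic Bz ν := (hβalg.mul hDalg).add (isAlgebraic_germEval₂ hwalg _)
  have hconst : ∀ c : ℂ, IsAlgebraic Bz (algebraMap ℂ (AGerm z₀) c) := fun c => by
    simpa [Polynomial.aeval_C] using isAlgebraic_aeval_zGerm z₀ (Polynomial.C c)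
  have hbalg : IsAlgebraic Bz b := (hconst (C * (k : ℂ))).mul hνalg
  -- `R` is algebraic over `ℂ[zGerm, a, b]`, hence over `ℂ[zGerm]`
  set s : Set (AGerm z₀) := {zGerm z₀, a, b} with hs
  set As := Algebra.adjoin ℂ s with hAs
  have haAs : a ∈ As := Algebra.subset_adjoin (by simp [hs])
  have hbAs : b ∈ As := Algebra.subset_adjoin (by simp [hs])
  set a' : As := ⟨a, haAs⟩ with ha'
  set b' : As := ⟨b, hbAs⟩ with hb'
  set F : Polynomial As := Polynomial.C a' * (derivative Pt).map (algebraMap ℂ As) -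
    Polynomial.C b' * Polynomial.X ^ (k - 1) with hFdef
  have hPt0 : Pt ≠ 0 := fun h => by rw [h, Polynomial.natDegree_zero] at hPt; omega
  have hPt'lc : (derivative Pt).coeff (Pt.natDegree - 1) ≠ 0 := by
    rw [Polynomial.coeff_derivative]
    refine mul_ne_zero ?_ (Nat.cast_add_one_ne_zero _)
    rw [Nat.sub_add_cancel (by omega : 1 ≤ Pt.natDegree)]
    exact Polynomial.leadingCoeff_ne_zero.2 hPt0
  have hFcoeff : F.coeff (Pt.natDegree - 1) =
      a' * algebraMap ℂ As ((derivative Pt).coeff (Pt.natDegree - 1)) := by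
    rw [hFdef, Polynomial.coeff_sub, Polynomial.coeff_C_mul, Polynomial.coeff_map,
      Polynomial.coeff_C_mul_X_pow, if_neg (by omega), sub_zero]
  have hF0 : F ≠ 0 := by
    intro hF
    have h := congrArg (fun P : Polynomial As => ((P.coeff (Pt.natDegree - 1) : As) : AGerm z₀)) hF
    simp only [hFcoeff, Polynomial.coeff_zero] at h
    rw [Subalgebra.coe_mul, Subalgebra.coe_algebraMap, ZeroMemClass.coe_zero] at h
    rcases mul_eq_zero.1 h with h1 | h2
    · exact ha0 h1
    · exact hPt'lc ((algebraMap ℂ (AGerm z₀)).injective (by rw [h2, map_zero]))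
  have hFroot : Polynomial.aeval RO F = 0 := by
    rw [hFdef, map_sub, map_mul, map_mul, Polynomial.aeval_C, Polynomial.aeval_C,
      Polynomial.aeval_map_algebraMap, map_pow, Polynomial.aeval_X]
    change a * Polynomial.aeval RO (derivative Pt) - b * RO ^ (k - 1) = 0
    rw [hab, sub_self]
  have hRalgAs : IsAlgebraic As RO := ⟨F, hF0, hFroot⟩
  have hRalg : IsAlgebraic Bz RO := by
    refine IsAlgebraic.adjoin_of_forall_isAlgebraic (R := ℂ) (s := s) (t := {zGerm z₀})
      (fun x hx => ?_) hRalgAs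
    have hx' : x = zGerm z₀ ∨ x = a ∨ x = b := by simpa [hs] using hx.1
    rcases hx' with rfl | rfl | rfl
    · exact hzalg
    · exact haalg
    · exact hbalg
  -- `L = z - τ - C R^k` is algebraic
  have hLeq : LO = zGerm z₀ - algebraMap ℂ (AGerm z₀) τ - algebraMap ℂ (AGerm z₀) C * RO ^ k := by
    have h1an : AnalyticAt ℂ (fun z => z - τ - C * R z ^ k) z₀ :=
      (analyticAt_id.sub analyticAt_const).sub (analyticAt_const.mul (hRan.pow k))
    have e1 : AGerm.mk z₀ h1an =
        zGerm z₀ - algebraMap ℂ (AGerm z₀) τ - algebraMap ℂ (AGerm z₀) C * RO ^ k := by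
      rw [zGerm, ← AGerm.mk_const, ← AGerm.mk_const, hRO, ← AGerm.mk_pow, ← AGerm.mk_mul,
        ← AGerm.mk_sub, ← AGerm.mk_sub]
      exact AGerm.mk_congr _ _ fun z => by simp
    rw [← e1, hLO, AGerm.mk_eq_mk_iff]
    filter_upwards [hR] with z hz
    linear_combination hz
  rw [hLeq]
  exact (hzalg.sub (hconst τ)).sub ((hconst C).mul (hRalg.pow k))

end Summit.Schanuel.Schanuel.Theorems
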